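import Literature.NumberTheory.Transcendental.Waldschmidt1980Numeric
import Literature.NumberTheory.Transcendental.Waldschmidt1980EndgameCW
import HarnessLib

/-!
# Waldschmidt 1980, Prop. 3.8 over `ℚ` (`q = 2`): the assembly

Support file (theorems only; no named facts) for the archimedean input of the Stewart–Yu 1991
line of `Literature.Barriers.ABC.stewartYu1991_upperBound` (M. Waldschmidt, *A lower bound for
linear forms in logarithms*, Acta Arith. **37** (1980), 257–283, Prop. 3.8 over `ℚ`, `q = 2`,
`D = 1`).

On the objects of the tree's Cijsouw–Waldschmidt files (`CW77.Setup`: `d` free positive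
rationals `αⱼ`, the eliminated one `θ`, `Λ₀ = ∑ βⱼ log αⱼ − log θ`), with Waldschmidt's parameters
(`Waldschmidt1980Params.lean`: DIFFERENT ranges `Lⱼ ∝ 1/Vⱼ`, `h ≍ W⋆/G`, `U ∝ Aᵐ m^{2m+1}/m!`):

* `W80Hyp.inv_zero` — Lemma 3.2 (Siegel): the invariant `Inv` at level `0`;
* `W80Hyp.kchain` — Lemma 3.6: at level `J < J₀`, the `d` inner extrapolations on the integer
  points `s < 2^{k+J} S₀ → s < 2^{k+1+J} S₀` (`CW77.Setup.w80_kstep_far`, Liouville (3.21));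
* `W80Hyp.inv_succ` — Lemma 3.7: the half-integer points (`w80_halfstep_far`, the sharp
  multiquadratic Liouville inequality (3.22)) and the `2`-descent (`CW77.Setup.descent_algebra`);
* `W80Hyp.main` — §3.5: at level `J₀` (`L_θ < 2^{J₀}`) the asymmetric endgame
  (`CW77.Setup.w80_endgame`) is contradictory; hence **`|Λ₀| > e^{−U}`**.

## References

* [Waldschmidt1980] M. Waldschmidt, *A lower bound for linear forms in logarithms*, Acta Arith. 37
  (1980), 257–283 — §3 (pp. 263–274).
* [CijsouwWaldschmidt1977] P. L. Cijsouw, M. Waldschmidt, Compositio Math. 34 (1977) — §4 (the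
  skeleton: the tree's `CijsouwWaldschmidt1977{Setup,Steps,Main}.lean`).
-/

noncomputable section

open Finset Real
open Literature.NumberTheory.Transcendental.Baker1975
open Literature.NumberTheory.Transcendental.Baker1975.Ch3
open Literature.NumberTheory.Transcendental.Waldschmidt1980
open Literature.NumberTheory.Transcendental.Waldschmidt1980.W80Par

namespace Literature.NumberTheory.Transcendental.Waldschmidt1980.W80Par

variable {d : ℕ} (P : W80Par d)

/-- `⌈N · 𝔅⁴E(2)⌉ ≤ Pr = 2𝔅⁵E(2)` when `0 ≤ N ≤ 𝔅`. [folklore] -/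
theorem ceil_le_PrV {N : ℝ} (hN : N ≤ P.𝔅) :
    ((⌈N * (P.𝔅 ^ 4 * P.Efac 2)⌉ : ℤ) : ℝ) ≤ P.PrV := by
  have h𝔅 := P.one_le_𝔅
  have hE : 1 ≤ P.Efac 2 := by unfold Efac; exact Real.one_le_exp (by unfold cL'; have := P.𝔘_pos; positivity)
  have h1 := (Int.ceil_lt_add_one (N * (P.𝔅 ^ 4 * P.Efac 2))).le
  have h2 : N * (P.𝔅 ^ 4 * P.Efac 2) ≤ P.𝔅 ^ 5 * P.Efac 2 := by
    calc N * (P.𝔅 ^ 4 * P.Efac 2) ≤ P.𝔅 * (P.𝔅 ^ 4 * P.Efac 2) := mul_le_mul_of_nonneg_right hN (by positivity)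
      _ = P.𝔅 ^ 5 * P.Efac 2 := by ring
  have h3 : 1 ≤ P.𝔅 ^ 5 * P.Efac 2 := one_le_mul_of_one_le_of_one_le (one_le_pow₀ h𝔅) hE
  unfold PrV; linarith

/-- `1 ≤ Pr`. [folklore] -/
theorem one_le_PrV : 1 ≤ P.PrV := by
  have h𝔅 := P.one_le_𝔅
  have hE : 1 ≤ P.Efac 2 := by unfold Efac; exact Real.one_le_exp (by unfold cL'; have := P.𝔘_pos; positivity)
  have h3 : 1 ≤ P.𝔅 ^ 5 * P.Efac 2 := one_le_mul_of_one_le_of_one_le (one_le_pow₀ h𝔅) hE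
  unfold PrV; linarith

/-! ### The endgame count -/

omit P in
/-- `#{s < 2n : s odd} = n`. [folklore] -/
theorem card_filter_odd_range_two_mul (n : ℕ) : ((range (2 * n)).filter Odd).card = n := by
  induction n with
  | zero => simp
  | succ n ih =>
    rw [show 2 * (n + 1) = (2 * n + 1) + 1 by ring, range_add_one, range_add_one, filter_insert, filter_insert]
    have hodd : Odd (2 * n + 1) := ⟨n, rfl⟩
    have heven : ¬ Odd (2 * n) := by rw [Nat.not_odd_iff_even]; exact ⟨n, by ring⟩
    rw [if_pos hodd, if_neg heven, card_insert_of_notMem, ih]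
    simp

/-- `#{s < 2^{J₀} S₀ : s odd} = 2^{J₀} ⌊c_S m W⋆⌋` (`S₀ = 2⌊c_S m W⋆⌋`). [folklore] -/
theorem card_odd_eq : ((range (2 ^ P.J₀ * P.S₀)).filter Odd).card = 2 ^ P.J₀ * ⌊cS * mR d * P.Wstar⌋₊ := by
  unfold S₀
  rw [show 2 ^ P.J₀ * (2 * ⌊cS * mR d * P.Wstar⌋₊) = 2 * (2 ^ P.J₀ * ⌊cS * mR d * P.Wstar⌋₊) by ring]
  exact card_filter_odd_range_two_mul _

/-- `∑ⱼ ⌊Lⱼ/2^{J₀}⌋ ≤ 4 m V_θ` (real): `Lⱼ ≤ (2L_θ+2)V_θ`, `2^{J₀} > L_θ`. [folklore] -/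
theorem sum_L_div_le : ((∑ j, P.L j / 2 ^ P.J₀ : ℕ) : ℝ) ≤ 4 * mR d * P.Vθ := by
  have hLθ := P.Lθ_ge
  have hden := P.den_Lθ_pos
  have hL1 : (1 : ℝ) ≤ P.Lθ := by exact_mod_cast P.one_le_Lθ
  have hJ : (P.Lθ : ℝ) < (2 : ℝ) ^ P.J₀ := by exact_mod_cast P.Lθ_lt_two_pow
  have hVθ := P.one_le_Vθ
  have hj : ∀ j, ((P.L j / 2 ^ P.J₀ : ℕ) : ℝ) ≤ 4 * P.Vθ := by
    intro j
    have h1 : ((P.L j / 2 ^ P.J₀ : ℕ) : ℝ) ≤ (P.L j : ℝ) / 2 ^ P.J₀ := by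
      have := Nat.cast_div_le (α := ℝ) (m := P.L j) (n := 2 ^ P.J₀); push_cast at this; exact this
    have h0 : 0 < cL' * mR d * 2 ^ (d + 2) * (P.S₀ : ℝ) := by unfold cL'; have := mR_pos P; have := P.S₀_pos; positivity
    have hVj := P.hV j
    have hU := P.U_pos
    have hLj : (P.L j : ℝ) ≤ P.U / (cL' * mR d * 2 ^ (d + 2) * P.S₀ * P.V j) := by
      unfold L; exact Nat.floor_le (div_nonneg hU.le (by positivity))
    have h3 : P.U / (cL' * mR d * 2 ^ (d + 2) * P.S₀ * P.V j) ≤ P.U / (cL' * mR d * 2 ^ (d + 2) * P.S₀ * P.Vθ) * P.Vθ := by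
      have h3a : P.U / (cL' * mR d * 2 ^ (d + 2) * P.S₀ * P.V j) ≤ P.U / (cL' * mR d * 2 ^ (d + 2) * P.S₀) :=
        div_le_div_of_nonneg_left hU.le h0 (le_mul_of_one_le_right h0.le hVj)
      have h3b : P.U / (cL' * mR d * 2 ^ (d + 2) * P.S₀) = P.U / (cL' * mR d * 2 ^ (d + 2) * P.S₀ * P.Vθ) * P.Vθ := by
        field_simp
      rw [← h3b]; exact h3a
    have h5 : (P.L j : ℝ) ≤ (2 * P.Lθ + 2) * P.Vθ := hLj.trans (h3.trans (by nlinarith))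
    have h6 : (P.L j : ℝ) / 2 ^ P.J₀ ≤ (2 * P.Lθ + 2) * P.Vθ / P.Lθ := by
      calc (P.L j : ℝ) / 2 ^ P.J₀ ≤ (P.L j : ℝ) / P.Lθ := div_le_div_of_nonneg_left (Nat.cast_nonneg _) (by linarith) hJ.le
        _ ≤ (2 * P.Lθ + 2) * P.Vθ / P.Lθ := div_le_div_of_nonneg_right h5 (by linarith)
    have h7 : (2 * P.Lθ + 2) * P.Vθ / P.Lθ ≤ 4 * P.Vθ := by
      rw [div_le_iff₀ (by linarith)]; nlinarith
    linarith
  push_cast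
  calc ∑ j, ((P.L j / 2 ^ P.J₀ : ℕ) : ℝ) ≤ ∑ _j : Fin d, 4 * P.Vθ := sum_le_sum fun j _ => hj j
    _ = d * (4 * P.Vθ) := by simp
    _ ≤ 4 * mR d * P.Vθ := by unfold mR; nlinarith

/-- `T/2^{J₀} ≥ 2¹⁰ m² V_θ − 1` (real). [folklore] -/
theorem T_div_ge : (2 : ℝ) ^ 10 * mR d ^ 2 * P.Vθ - 1 ≤ ((P.T / 2 ^ P.J₀ : ℕ) : ℝ) := by
  have h1 := natDiv_ge_real P.T (2 ^ P.J₀) (Nat.pow_pos two_pos)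
  push_cast at h1
  have h2 := P.T_ge_Lθ
  have h3 : ((2 : ℝ) ^ P.J₀) ≤ 2 * P.Lθ := by exact_mod_cast P.two_pow_le
  have hL1 : (1 : ℝ) ≤ P.Lθ := by exact_mod_cast P.one_le_Lθ
  have h4 : (2 : ℝ) ^ 10 * mR d ^ 2 * P.Vθ ≤ (P.T : ℝ) / 2 ^ P.J₀ := by
    rw [le_div_iff₀ (by positivity)]
    calc (2 : ℝ) ^ 10 * mR d ^ 2 * P.Vθ * 2 ^ P.J₀ ≤ 2 ^ 10 * mR d ^ 2 * P.Vθ * (2 * P.Lθ) := by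
          have := P.one_le_Vθ; gcongr
      _ = 2 ^ 11 * mR d ^ 2 * P.Vθ * P.Lθ := by ring
      _ ≤ P.T := h2
  linarith

/-- **The numbers of the endgame**: `∑ⱼ ⌊Lⱼ/2^{J₀}⌋ + 1 ≤ ⌊T/2^{J₀}⌋` and
`h L_b < (⌊T/2^{J₀}⌋ − ∑ⱼ ⌊Lⱼ/2^{J₀}⌋) · #{odd s < 2^{J₀} S₀}` (the latter is `≥ m 𝔘/128`, the
former `≤ 𝔘/c_L + 3W⋆`). [cite: Waldschmidt1980, §3.5 (p. 274)] -/
theorem endgame_numbers :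
    (∑ j, P.L j / 2 ^ P.J₀) + 1 ≤ P.T / 2 ^ P.J₀ ∧
      P.hpar * P.Lb < (P.T / 2 ^ P.J₀ - ∑ j, P.L j / 2 ^ P.J₀) * ((range (2 ^ P.J₀ * P.S₀)).filter Odd).card := by
  have hsum := P.sum_L_div_le
  have hTd := P.T_div_ge
  have hm := two_le_mR P; have hm0 := mR_pos P; have hVθ := P.one_le_Vθ; have hW := P.one_le_Wstar
  have hU := P.𝔘_pos
  -- (1) the first claim, in the reals
  have h1real : ((∑ j, P.L j / 2 ^ P.J₀ : ℕ) : ℝ) + 1 ≤ ((P.T / 2 ^ P.J₀ : ℕ) : ℝ) := by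
    have : 4 * mR d * P.Vθ + 1 ≤ (2 : ℝ) ^ 10 * mR d ^ 2 * P.Vθ - 1 := by nlinarith
    linarith
  have h1 : (∑ j, P.L j / 2 ^ P.J₀) + 1 ≤ P.T / 2 ^ P.J₀ := by exact_mod_cast h1real
  refine ⟨h1, ?_⟩
  -- (2) the second claim
  rw [P.card_odd_eq]
  have hsub : (((P.T / 2 ^ P.J₀ - ∑ j, P.L j / 2 ^ P.J₀ : ℕ)) : ℝ) = ((P.T / 2 ^ P.J₀ : ℕ) : ℝ) - ((∑ j, P.L j / 2 ^ P.J₀ : ℕ) : ℝ) := by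
    rw [Nat.cast_sub (by omega)]
  have hT' : (2 : ℝ) ^ 9 * mR d ^ 2 * P.Vθ ≤ ((P.T / 2 ^ P.J₀ - ∑ j, P.L j / 2 ^ P.J₀ : ℕ) : ℝ) := by
    rw [hsub]; nlinarith
  -- `#odd = 2^{J₀} ⌊c_S m W⋆⌋ ≥ Lθ (c_S m W⋆ − 1) ≥ Lθ c_S m W⋆ / 2`
  have hfl : cS * mR d * P.Wstar - 1 ≤ (⌊cS * mR d * P.Wstar⌋₊ : ℝ) := by
    have := Nat.lt_floor_add_one (cS * mR d * P.Wstar); linarith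
  have hcS := P.cS_mul_ge
  have hJ : (P.Lθ : ℝ) ≤ (2 : ℝ) ^ P.J₀ := by exact_mod_cast P.Lθ_lt_two_pow.le
  have hodd : (P.Lθ : ℝ) * (cS * mR d * P.Wstar / 2) ≤ ((2 ^ P.J₀ * ⌊cS * mR d * P.Wstar⌋₊ : ℕ) : ℝ) := by
    push_cast
    have h2 : cS * mR d * P.Wstar / 2 ≤ (⌊cS * mR d * P.Wstar⌋₊ : ℝ) := by linarith
    exact mul_le_mul hJ h2 (by linarith) (by positivity)
  -- `Lθ Vθ ≥ 𝔘/(8 c_L' c_S m² W⋆)`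
  have hLθ := P.Lθ_ge
  have hS := P.S₀_le; have hS0 := P.S₀_pos
  have hLV : P.𝔘 / (8 * cL' * cS * mR d ^ 2 * P.Wstar) ≤ (P.Lθ : ℝ) * P.Vθ := by
    have hden := P.den_Lθ_pos
    have e : P.U / (cL' * mR d * 2 ^ (d + 2) * P.S₀ * P.Vθ) / 2 = P.𝔘 / (4 * cL' * mR d * P.S₀ * P.Vθ) := by
      rw [P.U_eq, pow_succ]; field_simp; ring
    rw [e] at hLθ
    have h2 : P.𝔘 / (8 * cL' * cS * mR d ^ 2 * P.Wstar) ≤ P.𝔘 / (4 * cL' * mR d * P.S₀ * P.Vθ) * P.Vθ := by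
      rw [div_mul_eq_mul_div, div_le_div_iff₀ (by unfold cL' cS; positivity) (by unfold cL'; positivity)]
      -- `𝔘 (4 c_L' m S₀ Vθ) ≤ 𝔘 Vθ (8 c_L' c_S m² W⋆)` iff `S₀ ≤ 2 c_S m W⋆`
      have : 4 * cL' * mR d * (P.S₀ : ℝ) ≤ 8 * cL' * cS * mR d ^ 2 * P.Wstar := by unfold cL' cS at *; nlinarith
      have h0 : 0 ≤ P.𝔘 * P.Vθ := by positivity
      nlinarith
    calc P.𝔘 / (8 * cL' * cS * mR d ^ 2 * P.Wstar) ≤ P.𝔘 / (4 * cL' * mR d * P.S₀ * P.Vθ) * P.Vθ := h2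
      _ ≤ (P.Lθ : ℝ) * P.Vθ := mul_le_mul_of_nonneg_right hLθ (by linarith)
  -- assemble in the reals
  have hlhs := P.hparLb_le
  have hWU := P.Wstar_le_𝔘
  suffices key : (P.hpar : ℝ) * P.Lb < ((P.T / 2 ^ P.J₀ - ∑ j, P.L j / 2 ^ P.J₀ : ℕ) : ℝ) * ((2 ^ P.J₀ * ⌊cS * mR d * P.Wstar⌋₊ : ℕ) : ℝ) by
    exact_mod_cast key
  have hprod : (2 : ℝ) ^ 9 * mR d ^ 2 * P.Vθ * ((P.Lθ : ℝ) * (cS * mR d * P.Wstar / 2)) ≤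
      ((P.T / 2 ^ P.J₀ - ∑ j, P.L j / 2 ^ P.J₀ : ℕ) : ℝ) * ((2 ^ P.J₀ * ⌊cS * mR d * P.Wstar⌋₊ : ℕ) : ℝ) :=
    by
      have hc : (0 : ℝ) < cS := by unfold cS; norm_num
      have h0 : (0 : ℝ) ≤ cS * mR d * P.Wstar / 2 := by positivity
      exact mul_le_mul hT' hodd (mul_nonneg (Nat.cast_nonneg _) h0) (Nat.cast_nonneg _)
  refine lt_of_lt_of_le ?_ hprod
  -- `2^9 m² Vθ Lθ c_S m W⋆/2 ≥ 2^8 c_S m³ W⋆ · 𝔘/(8 c_L' c_S m² W⋆) = 32 m 𝔘/c_L' ≥ 𝔘/64 > 𝔘/c_L + 3 W⋆`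
  have h32 : P.𝔘 / 64 ≤ (2 : ℝ) ^ 9 * mR d ^ 2 * P.Vθ * ((P.Lθ : ℝ) * (cS * mR d * P.Wstar / 2)) := by
    have e : (2 : ℝ) ^ 9 * mR d ^ 2 * P.Vθ * ((P.Lθ : ℝ) * (cS * mR d * P.Wstar / 2)) =
        (2 ^ 8 * cS * mR d ^ 3 * P.Wstar) * ((P.Lθ : ℝ) * P.Vθ) := by ring
    rw [e]
    have h0 : (0 : ℝ) ≤ 2 ^ 8 * cS * mR d ^ 3 * P.Wstar := by unfold cS; positivity
    calc P.𝔘 / 64 ≤ (2 ^ 8 * cS * mR d ^ 3 * P.Wstar) * (P.𝔘 / (8 * cL' * cS * mR d ^ 2 * P.Wstar)) := by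
          unfold cL' cS
          rw [mul_div_assoc', le_div_iff₀ (by positivity)]
          have h0' : 0 ≤ mR d ^ 2 * P.Wstar * P.𝔘 := by positivity
          have h2m := mul_le_mul_of_nonneg_left hm h0'
          calc P.𝔘 / 64 * (8 * (2 : ℝ) ^ 12 * 2 ^ 13 * mR d ^ 2 * P.Wstar) = 2 ^ 22 * (mR d ^ 2 * P.Wstar * P.𝔘) := by ring
            _ ≤ 2 ^ 21 * (mR d * (mR d ^ 2 * P.Wstar * P.𝔘)) := by nlinarith
            _ = 2 ^ 8 * 2 ^ 13 * mR d ^ 3 * P.Wstar * P.𝔘 := by ring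
      _ ≤ (2 ^ 8 * cS * mR d ^ 3 * P.Wstar) * ((P.Lθ : ℝ) * P.Vθ) := mul_le_mul_of_nonneg_left hLV h0
  have : P.𝔘 / cL + 3 * P.Wstar < P.𝔘 / 64 := by unfold cL; nlinarith
  linarith

end Literature.NumberTheory.Transcendental.Waldschmidt1980.W80Par

namespace Literature.NumberTheory.Transcendental.CW77

namespace Setup

variable {S : Setup} {P : W80Par S.d} (hy : S.W80Hyp P)
include hy

/-! ### Level `0`: Siegel's lemma -/

/-- **Lemma 3.2 (Siegel's lemma): the invariant at level `0`**, with the integer bound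
`⌈#box₀ · 𝔅⁴E(2)⌉`. [cite: Waldschmidt1980, Lemma 3.2 (pp. 266–267)] -/
theorem W80Hyp.inv_zero :
    ∃ p : Idx S.d P.hpar P.Lb → ℤ,
      S.Inv P.J₀ P.L P.Lθ P.S₀ P.T ⌈((S.box (h := P.hpar) (Lb := P.Lb) P.L P.Lθ 0).card : ℝ) * (P.𝔅 ^ 4 * P.Efac 2)⌉ 0 p := by
  have hS₀ : 1 ≤ P.S₀ := by have := P.two_le_S₀; omega
  have hAmax : 1 ≤ P.𝔅 ^ 4 * P.Efac 2 := by
    have h𝔅 := P.one_le_𝔅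
    have hE : 1 ≤ P.Efac 2 := by unfold W80Par.Efac; exact Real.one_le_exp (by unfold cL'; have := P.𝔘_pos; positivity)
    exact one_le_mul_of_one_le_of_one_le (one_le_pow₀ h𝔅) hE
  refine S.siegel_step P.J₀ P.L P.Lθ P.S₀ P.T hS₀ P.one_le_T (w80_siegel_count P) hAmax ?_
  intro s hs τ hτ u hu
  have := hy.abs_Dclear_qTerm_le hs hτ hu
  unfold W80Par.Efac; exact this

/-! ### Level `J < J₀`: the inner chain of Lemma 3.6 -/

/-- **Lemma 3.6: the inner induction at level `J < J₀`.** From the invariant at level `J`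
(`coreSum = 0` for odd `s < 2ᴶ S₀`, `|τ| < T/2ᴶ`): for every `k ≤ d`, `coreSum = 0` for odd
`s < 2^{k+J} S₀` and `|τ| < T/2ᴶ − k t_J`. Each step is `w80_kstep_far` (Hermite on the
`2^{k+J} S₀/2` odd nodes with `t_J` derivatives, Liouville (3.21) at the integer points, the
numbers of `W80Par.final_kstep`). [cite: Waldschmidt1980, Lemma 3.6 (p. 272)] -/
theorem W80Hyp.kchain (hΛ : |S.Λ₀| ≤ Real.exp (-P.U)) {J : ℕ} (hJ : J < P.J₀) {Pint : ℤ}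
    (hPint : (Pint : ℝ) ≤ P.PrV) {p : Idx S.d P.hpar P.Lb → ℤ} (inv : S.Inv P.J₀ P.L P.Lθ P.S₀ P.T Pint J p) :
    ∀ k, k ≤ S.d → ∀ s, s < 2 ^ (k + J) * P.S₀ → Odd s → ∀ τ : Tau S.d, tauNorm τ < P.T / 2 ^ J - k * P.tJ J →
      S.coreSum P.J₀ J (S.box (h := P.hpar) (Lb := P.Lb) P.L P.Lθ J) p τ s = 0 := by
  obtain ⟨hLθΛ, hx1, hxall⟩ := w80_smallness P hΛ
  intro k
  induction k with
  | zero =>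
    intro _ s hs hodd τ hτ
    rw [zero_add] at hs
    exact inv.rel s hs hodd τ (by simpa using hτ)
  | succ k ih =>
    intro hk s hs hodd τ hτ
    have hk' : k < S.d := by omega
    have hzero := ih hk'.le
    -- the step `k → k+1`
    have htJ := P.tJ_mul_le J
    have ht1 := P.one_le_tJ hJ
    have hS2 := P.two_le_S₀
    have hSK : 2 ≤ 2 ^ (k + J) * P.S₀ := le_trans hS2 (Nat.le_mul_of_pos_left _ (Nat.pow_pos two_pos))
    have hSKe : Even (2 ^ (k + J) * P.S₀) := by
      obtain ⟨r, hr⟩ := P.even_S₀; exact ⟨2 ^ (k + J) * r, by rw [hr]; ring⟩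
    have key := S.w80_kstep_far (J₀ := P.J₀) (J := J) (L := P.L) (Lθ := P.Lθ) (p := p)
      (SK := 2 ^ (k + J) * P.S₀) (Tlo := P.T / 2 ^ J - k * P.tJ J) (t := P.tJ J) hSK hSKe ht1 hzero
      (Nr := P.𝔅) (w80_card_box_le_𝔅 P J) P.one_le_𝔅
      (Q := P.𝔅) (GA := P.𝔅) (Ψ := P.ΨV J) (x := P.xV) (Cl := P.ClV) (Pr := P.PrV)
      (Dmax := P.𝔅 ^ 2 * P.Efac ((2 ^ (k + 1) : ℕ) : ℝ))
      (fun u _ => le_trans (by exact_mod_cast inv.bound u) hPint) P.one_le_PrV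
      (fun u _ m hm z hz => w80_norm_Qw_wOf_le P hJ.le u
        (hm.trans ((Nat.sub_le _ _).trans (Nat.div_le_self _ _)))
        (hz.trans (by
          have : ((2 ^ (k + J) * P.S₀ : ℕ) : ℝ) ≤ ((2 ^ (S.d + J) * P.S₀ : ℕ) : ℝ) := by
            exact_mod_cast Nat.mul_le_mul_right _ (Nat.pow_le_pow_right two_pos (by omega))
          linarith)))
      P.one_le_𝔅
      (fun u hu τ' hτ' => hy.norm_A_le hu (hτ'.trans ((Nat.sub_le _ _).trans (Nat.div_le_self _ _))))
      P.one_le_𝔅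
      (fun u hu => ⟨(hy.abs_ψ_le hu).trans (by
          unfold W80Par.ΨV; exact div_le_div_of_nonneg_right (by linarith) (by positivity)),
        by unfold W80Par.ΨV; exact hy.abs_expo_le hu hLθΛ⟩)
      (by unfold W80Par.ΨV; have := P.sum_LV_nonneg; positivity)
      (by unfold W80Par.xV; exact hxall J k hk'.le) (by unfold W80Par.xV; exact hx1)
      (by unfold W80Par.xV; have := P.𝔅_pos; positivity)
      (by unfold W80Par.ClV; exact hy.one_add_sum_abs_l_le)
      (fun τ₁ hτ₁ s₁ hs₁ => hy.DclearJ_le hJ.le hk'.le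
        ((Nat.le_add_right _ _).trans (hτ₁.trans ((Nat.sub_le _ _).trans (Nat.div_le_self _ _))))
        (by rw [show k + 1 + J = (k + J) + 1 by ring, pow_succ]; linarith))
      (by
        have := P.final_kstep hJ hk'
        unfold W80Par.δV W80Par.ε₉V W80Par.BfV at this
        exact this)
    refine key s ?_ hodd τ ?_
    · rw [show k + 1 + J = (k + J) + 1 by ring, pow_succ] at hs; linarith
    · -- `|τ| < T/2^J − (k+1) t ⇒ |τ| + t ≤ T/2^J − k t`
      have h2 : (k + 1) * P.tJ J ≤ P.T / 2 ^ J := by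
        calc (k + 1) * P.tJ J ≤ 2 * (S.d + 1) * P.tJ J := Nat.mul_le_mul_right _ (by omega)
          _ ≤ P.T / 2 ^ J := htJ
      rw [Nat.succ_mul] at hτ
      omega

/-! ### Level `J → J + 1`: Lemma 3.7 and the descent -/

/-- **Lemma 3.7 and the `2`-descent: the invariant passes from level `J < J₀` to `J + 1`** (with the
same integer bound). After the `d` inner steps, `w80_halfstep_far` (Hermite once more, the sharp
multiquadratic Liouville inequality (3.22) at the half-integer points, the numbers of
`W80Par.final_half`) gives `φ_{J,τ}(s/2) = 0` for odd `s < 2^{J+1} S₀`, `|τ| < T/2^{J+1}`, and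
`CW77.Setup.descent_algebra` produces the coefficients of level `J + 1`.
[cite: Waldschmidt1980, Lemma 3.7 (pp. 272–273)] -/
theorem W80Hyp.inv_succ (hind : ∀ T : Finset (Fin (S.d + 1)), T.Nonempty → ¬ IsSquare (∏ i ∈ T, S.all i))
    (hΛ : |S.Λ₀| ≤ Real.exp (-P.U)) {J : ℕ} (hJ : J < P.J₀) {Pint : ℤ} (hPint : (Pint : ℝ) ≤ P.PrV)
    {p : Idx S.d P.hpar P.Lb → ℤ} (inv : S.Inv P.J₀ P.L P.Lθ P.S₀ P.T Pint J p) :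
    ∃ p' : Idx S.d P.hpar P.Lb → ℤ, S.Inv P.J₀ P.L P.Lθ P.S₀ P.T Pint (J + 1) p' := by
  obtain ⟨hLθΛ, hx1, hxall⟩ := w80_smallness P hΛ
  have hzero := hy.kchain hΛ hJ hPint inv S.d le_rfl
  have htJ := P.tJ_mul_le J
  have ht1 := P.one_le_tJ hJ
  have hS2 := P.two_le_S₀
  have hSK : 2 ≤ 2 ^ (S.d + J) * P.S₀ := le_trans hS2 (Nat.le_mul_of_pos_left _ (Nat.pow_pos two_pos))
  have hSKS : 2 ^ J * P.S₀ ≤ 2 ^ (S.d + J) * P.S₀ := Nat.mul_le_mul_right _ (Nat.pow_le_pow_right two_pos (by omega))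
  have hP1 : 1 ≤ heightProd S.all := by
    unfold heightProd
    have : ∏ _i : Fin (S.d + 1), (1 : ℝ) ≤ ∏ i, hgt (S.all i) :=
      prod_le_prod (fun _ _ => zero_le_one) fun i _ => one_le_hgt _
    simpa using this
  have half := S.w80_halfstep_far hind hJ (L := P.L) (Lθ := P.Lθ) (S₀ := P.S₀) (p := p)
    (SK := 2 ^ (S.d + J) * P.S₀) (Tlo := P.T / 2 ^ J - S.d * P.tJ J) (t := P.tJ J) hSK hSKS ht1 hzero
    (Nr := P.𝔅) (w80_card_box_le_𝔅 P J) P.one_le_𝔅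
    (Q := P.𝔅) (GA := P.𝔅) (Ψ := P.ΨV J) (x := P.xV) (Cl := P.ClV) (Pr := P.PrV)
    (Rmax := P.𝔅 ^ 2 * P.Efac 2) (Dmax := P.𝔅 ^ 2 * P.Efac 2)
    (fun u _ => le_trans (by exact_mod_cast inv.bound u) hPint) P.one_le_PrV
    (fun u _ m hm z hz => w80_norm_Qw_wOf_le P hJ.le u
      (hm.trans ((Nat.sub_le _ _).trans (Nat.div_le_self _ _))) hz)
    P.one_le_𝔅
    (fun u hu τ' hτ' => hy.norm_A_le hu (hτ'.trans ((Nat.sub_le _ _).trans (Nat.div_le_self _ _))))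
    P.one_le_𝔅
    (fun u hu => ⟨(hy.abs_ψ_le hu).trans (by
        unfold W80Par.ΨV; exact div_le_div_of_nonneg_right (by linarith) (by positivity)),
      by unfold W80Par.ΨV; exact hy.abs_expo_le hu hLθΛ⟩)
    (by unfold W80Par.ΨV; have := P.sum_LV_nonneg; positivity)
    (by unfold W80Par.xV; exact hxall J S.d le_rfl) (by unfold W80Par.xV; exact hx1)
    (by unfold W80Par.xV; have := P.𝔅_pos; positivity)
    (by unfold W80Par.ClV; exact hy.one_add_sum_abs_l_le)
    (fun u hu τ₁ hτ₁ s₁ hs₁ => by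
      have := hy.abs_rHalf_le hJ hu ((Nat.le_add_right _ _).trans (hτ₁.trans ((Nat.sub_le _ _).trans (Nat.div_le_self _ _)))) hs₁
      unfold W80Par.Efac; exact this)
    (by
      have h𝔅 := P.one_le_𝔅
      have hE : 1 ≤ P.Efac 2 := by unfold W80Par.Efac; exact Real.one_le_exp (by unfold cL'; have := P.𝔘_pos; positivity)
      exact one_le_mul_of_one_le_of_one_le (one_le_pow₀ h𝔅) hE)
    (fun τ₁ hτ₁ s₁ hs₁ => by
      have := hy.Dhalf_le hJ ((Nat.le_add_right _ _).trans (hτ₁.trans ((Nat.sub_le _ _).trans (Nat.div_le_self _ _)))) hs₁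
      unfold W80Par.Efac; exact this)
    (by
      have := P.final_half hJ hP1 hy.heightProd_le
      unfold W80Par.δV W80Par.ε₉V W80Par.BfV at this
      exact this)
  refine S.descent_algebra hind hJ inv fun s hs hodd τ hτ => half s hs hodd τ ?_
  -- `|τ| < T/2^{J+1} ⇒ |τ| + t ≤ T/2^J − d t`
  have hdiv : P.T / 2 ^ (J + 1) = P.T / 2 ^ J / 2 := by rw [pow_succ, Nat.div_div_eq_div_mul]
  rw [hdiv] at hτ
  have hB : (S.d + 1) * P.tJ J = S.d * P.tJ J + P.tJ J := by ring
  have hC : 2 * (S.d + 1) * P.tJ J = 2 * (S.d * P.tJ J + P.tJ J) := by ring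
  rw [hC] at htJ
  omega

/-- **The invariant at every level `J ≤ J₀`.** [cite: Waldschmidt1980, §3.4–3.5 (pp. 270–274)] -/
theorem W80Hyp.inv_all (hind : ∀ T : Finset (Fin (S.d + 1)), T.Nonempty → ¬ IsSquare (∏ i ∈ T, S.all i))
    (hΛ : |S.Λ₀| ≤ Real.exp (-P.U)) :
    ∀ J, J ≤ P.J₀ → ∃ p : Idx S.d P.hpar P.Lb → ℤ,
      S.Inv P.J₀ P.L P.Lθ P.S₀ P.T ⌈((S.box (h := P.hpar) (Lb := P.Lb) P.L P.Lθ 0).card : ℝ) * (P.𝔅 ^ 4 * P.Efac 2)⌉ J p := by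
  have hPint := P.ceil_le_PrV (w80_card_box_le_𝔅 P 0)
  intro J
  induction J with
  | zero => intro _; exact hy.inv_zero
  | succ J ih =>
    intro hJ
    obtain ⟨p, inv⟩ := ih (by omega)
    exact hy.inv_succ hind hΛ (by omega) hPint inv

/-- **Waldschmidt 1980, Proposition 3.8 over `ℚ` with `q = 2` — the machine.** If the numbers
`α₁, …, α_d, θ` are multiplicatively independent modulo squares (`[ℚ(√α) : ℚ] = 2^{d+1}`) and the
sizes are as in `W80Hyp`, then `|β₁ log α₁ + ⋯ + β_d log α_d − log θ| > e^{−U}` with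
`U = Aᵐ · m^{2m+1}/m! · (∏ Vⱼ) V_θ · W⋆ · G` (`m = d + 1`). [cite: Waldschmidt1980, Prop. 3.8 and §3.5 (pp. 263, 274)] -/
theorem W80Hyp.main (hind : ∀ T : Finset (Fin (S.d + 1)), T.Nonempty → ¬ IsSquare (∏ i ∈ T, S.all i)) :
    Real.exp (-P.U) < |S.Λ₀| := by
  by_contra hcon
  push Not at hcon
  obtain ⟨p, inv⟩ := hy.inv_all hind hcon P.J₀ le_rfl
  obtain ⟨h1, h2⟩ := P.endgame_numbers
  exact S.w80_endgame inv P.Lθ_lt_two_pow (T' := P.T / 2 ^ P.J₀ - ∑ j, P.L j / 2 ^ P.J₀) (by omega) h2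

end Setup

end Literature.NumberTheory.Transcendental.CW77

end
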